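import Mathlib
import Summits.AnomalousDissipation.AnomalousDissipation.Theorems.WazewskiBlockUniformGalerkinTrapStubCalibration
import HarnessLib

/-!
# Crux `WazewskiBlock.UniformGalerkinTrap` (stmt-AnomalousDissipation-10352), line `SketchIdeator5`:
# mean loudness ⇒ pointwise loudness (the card's lever in abstract form)

Tools of the line `SketchIdeator5` (card `mane-calibrated-injection-floor`), abstract and reusable by any
ensemble-level route:

* `floor_of_boundedDeficit` — a signal continuous on `[0,∞)`, `L`-Lipschitz there (`L > 0`), whose cumulative
  deficit below the level `β` is at most `C` on every window, never dips below `β - √(2 C L)` (pure real analysis;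
  the proof of the skeleton's `stub_floor`).
* `floor_of_boundedDeficit_of_nonneg` — the same for `L ≥ 0` (limit `δ → 0` in `L + δ`).
* `ae_floor_of_boundedExcess` — **mean → pointwise**: for a measurable semiflow with an invariant probability law
  `μ`, a bounded measurable observable `W` continuous along orbits with mean `β`, bounded `β`-EXCESS `C` along a.e.
  orbit and `L`-Lipschitz values along a.e. orbit, `μ`-a.e. orbit satisfies `W (φ t x) ≥ β - √(2 C L)` for ALL
  `t ≥ 0` (Mañé calibration `stub_calibration` + the floor lemma).
* `stub_meanToPointwiseTools` — the registered tools stub (conjunction of the three), last theorem.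
-/

noncomputable section

-- `Summit.<Summit>.<Problem>` is the tree's mandated summit-side namespace (CONVENTIONS §2); deliberate duplicate.
set_option linter.dupNamespace false

namespace Summit.AnomalousDissipation.AnomalousDissipation.Theorems.UniformGalerkinTrap.Mane

open MeasureTheory Set Filter Topology Function

/-- **Bounded deficit + time-Lipschitz ⇒ pointwise floor.** Let `w : ℝ → ℝ` be continuous on `[0,∞)` and
`L`-Lipschitz there (`L > 0`), and suppose its cumulative deficit below the level `β` is bounded by `C` on every
window: `β (t - s) - C ≤ ∫ₛᵗ w` for `0 ≤ s ≤ t`. Then `w t ≥ β - √(2 C L)` for all `t ≥ 0`: a dip of depth `d` at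
`t₀` forces `w ≤ β - d + L (τ - t₀)` on `[t₀, t₀ + d/L]`, a deficit `d²/(2L) ≤ C`. [folklore] -/
theorem floor_of_boundedDeficit {w : ℝ → ℝ} {L C β : ℝ} (hL : 0 < L)
    (hcont : ContinuousOn w (Ici 0))
    (hlip : ∀ s t : ℝ, 0 ≤ s → 0 ≤ t → |w t - w s| ≤ L * |t - s|)
    (hdef : ∀ s t : ℝ, 0 ≤ s → s ≤ t → β * (t - s) - C ≤ ∫ τ in s..t, w τ) :
    ∀ t : ℝ, 0 ≤ t → β - Real.sqrt (2 * C * L) ≤ w t := by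
  intro t₀ ht₀
  set d : ℝ := β - w t₀ with hd
  by_cases hdle : d ≤ 0
  · have h0 : 0 ≤ Real.sqrt (2 * C * L) := Real.sqrt_nonneg _
    linarith
  push Not at hdle
  set h : ℝ := d / L with hh
  have hhpos : 0 < h := div_pos hdle hL
  -- the affine majorant on the window `[t₀, t₀ + h]`
  have hle : ∀ τ ∈ Icc t₀ (t₀ + h), w τ ≤ (β - d) + L * (τ - t₀) := by
    intro τ hτ
    have hτ0 : 0 ≤ τ := le_trans ht₀ hτ.1
    have h1 := hlip t₀ τ ht₀ hτ0
    have habs : |τ - t₀| = τ - t₀ := abs_of_nonneg (by linarith [hτ.1])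
    rw [habs] at h1
    have h2 : w τ - w t₀ ≤ L * (τ - t₀) := le_trans (le_abs_self _) h1
    have hw0 : w t₀ = β - d := by rw [hd]; ring
    linarith
  -- integrability on the window
  have hIcc : Icc t₀ (t₀ + h) ⊆ Ici 0 := fun τ hτ => le_trans ht₀ hτ.1
  have hwint : IntervalIntegrable w volume t₀ (t₀ + h) := by
    apply ContinuousOn.intervalIntegrable
    rw [uIcc_of_le (by linarith)]
    exact hcont.mono hIcc
  have hgcont : Continuous fun τ : ℝ => (β - d) + L * (τ - t₀) := by fun_prop
  have hgint : IntervalIntegrable (fun τ : ℝ => (β - d) + L * (τ - t₀)) volume t₀ (t₀ + h) :=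
    hgcont.intervalIntegrable _ _
  -- the integral of the majorant, by the fundamental theorem of calculus
  have hderiv : ∀ τ ∈ uIcc t₀ (t₀ + h),
      HasDerivAt (fun τ : ℝ => (β - d - L * t₀) * τ + L / 2 * τ ^ 2) ((β - d) + L * (τ - t₀)) τ := by
    intro τ _
    have h1 : HasDerivAt (fun τ : ℝ => (β - d - L * t₀) * τ) (β - d - L * t₀) τ := by
      simpa using (hasDerivAt_id τ).const_mul (β - d - L * t₀)
    have h2 : HasDerivAt (fun τ : ℝ => L / 2 * τ ^ 2) (L / 2 * (2 * τ)) τ := by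
      have h3 := (hasDerivAt_pow 2 τ).const_mul (L / 2)
      simpa using h3
    exact (h1.add h2).congr_deriv (by ring)
  have hgval : ∫ τ in t₀..(t₀ + h), ((β - d) + L * (τ - t₀)) = (β - d) * h + L * h ^ 2 / 2 := by
    rw [intervalIntegral.integral_eq_sub_of_hasDerivAt hderiv hgint]
    ring
  -- compare with the deficit hypothesis on the same window
  have hup : ∫ τ in t₀..(t₀ + h), w τ ≤ (β - d) * h + L * h ^ 2 / 2 := by
    rw [← hgval]
    exact intervalIntegral.integral_mono_on (by linarith) hwint hgint hle
  have hlow := hdef t₀ (t₀ + h) ht₀ (by linarith)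
  have hkey : (β - d) * h + L * h ^ 2 / 2 = β * h - d ^ 2 / (2 * L) := by
    rw [hh]; field_simp; ring
  have hsq : d ^ 2 / (2 * L) ≤ C := by nlinarith [hup, hlow, hkey]
  have hsq' : d ^ 2 ≤ 2 * C * L := by
    have h2L : 0 < 2 * L := by positivity
    have := (div_le_iff₀ h2L).mp hsq
    nlinarith [this]
  have hdroot : d ≤ Real.sqrt (2 * C * L) := by
    rw [show d = Real.sqrt (d ^ 2) from (Real.sqrt_sq hdle.le).symm]
    exact Real.sqrt_le_sqrt hsq'
  linarith

/-- The floor lemma with a NONNEGATIVE Lipschitz constant (`L ≥ 0`): apply `floor_of_boundedDeficit` with `L + δ`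
and let `δ → 0⁺` (continuity of `δ ↦ √(2 C (L + δ))`). [folklore] -/
theorem floor_of_boundedDeficit_of_nonneg {w : ℝ → ℝ} {L C β : ℝ} (hL : 0 ≤ L)
    (hcont : ContinuousOn w (Ici 0))
    (hlip : ∀ s t : ℝ, 0 ≤ s → 0 ≤ t → |w t - w s| ≤ L * |t - s|)
    (hdef : ∀ s t : ℝ, 0 ≤ s → s ≤ t → β * (t - s) - C ≤ ∫ τ in s..t, w τ) :
    ∀ t : ℝ, 0 ≤ t → β - Real.sqrt (2 * C * L) ≤ w t := by
  intro t ht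
  have hδ : ∀ δ : ℝ, 0 < δ → β - Real.sqrt (2 * C * (L + δ)) ≤ w t := by
    intro δ hδ
    refine floor_of_boundedDeficit (by linarith) hcont (fun s u hs hu => ?_) hdef t ht
    exact (hlip s u hs hu).trans (mul_le_mul_of_nonneg_right (by linarith) (abs_nonneg _))
  have hlim : Tendsto (fun δ : ℝ => β - Real.sqrt (2 * C * (L + δ))) (𝓝[>] 0)
      (𝓝 (β - Real.sqrt (2 * C * (L + 0)))) := by
    refine tendsto_nhdsWithin_of_tendsto_nhds ?_
    have hc : Continuous fun δ : ℝ => β - Real.sqrt (2 * C * (L + δ)) := by fun_prop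
    exact hc.tendsto 0
  rw [add_zero] at hlim
  exact le_of_tendsto hlim (eventually_nhdsWithin_of_forall fun δ hδ' => hδ δ hδ')

/-- **Mean loudness ⇒ pointwise loudness (a.e. orbit).** For a measurable semiflow `φ` with an invariant
probability law `μ`, a bounded measurable observable `W` continuous along forward orbits with mean `∫ W dμ = β`,
whose `β`-excess along a.e. orbit is at most `C` and whose values along a.e. orbit are `L`-Lipschitz in time
(`L ≥ 0`): `μ`-a.e. orbit satisfies `β - √(2 C L) ≤ W (φ t x)` for all `t ≥ 0` (Mañé calibration
`stub_calibration`, then `floor_of_boundedDeficit_of_nonneg` along the orbit). [cite: Jenkinson2006, Prop. 2.1–2.2] -/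
theorem ae_floor_of_boundedExcess {X : Type*} [MeasurableSpace X] (φ : ℝ → X → X) (μ : Measure X)
    [IsProbabilityMeasure μ] (W : X → ℝ) {β C L : ℝ}
    (hmeas : ∀ t : ℝ, 0 ≤ t → Measurable (φ t)) (h0 : ∀ x, φ 0 x = x)
    (hsemi : ∀ s t : ℝ, 0 ≤ s → 0 ≤ t → ∀ x, φ (s + t) x = φ s (φ t x))
    (hinv : ∀ t : ℝ, 0 ≤ t → μ.map (φ t) = μ) (hWm : Measurable W) (hWb : ∃ B : ℝ, ∀ x, |W x| ≤ B)
    (hWc : ∀ x, ContinuousOn (fun t => W (φ t x)) (Ici 0)) (hmean : ∫ x, W x ∂μ = β)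
    (hexcess : ∀ᵐ x ∂μ, ∀ t : ℝ, 0 ≤ t → ∫ τ in (0 : ℝ)..t, W (φ τ x) ≤ β * t + C)
    (hL : 0 ≤ L)
    (hlip : ∀ᵐ x ∂μ, ∀ s t : ℝ, 0 ≤ s → 0 ≤ t → |W (φ t x) - W (φ s x)| ≤ L * |t - s|) :
    ∀ᵐ x ∂μ, ∀ t : ℝ, 0 ≤ t → β - Real.sqrt (2 * C * L) ≤ W (φ t x) := by
  have hcal := stub_calibration φ μ W β C hmeas h0 hsemi hinv hWm hWb hWc hmean hexcess
  filter_upwards [hcal, hlip] with x hdef hlipx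
  exact floor_of_boundedDeficit_of_nonneg hL (hWc x) hlipx hdef

/-- Registered tools stub of the line `SketchIdeator5` (`ledger workitem stub-add … --name stub_meanToPointwiseTools`):
the floor lemma (`L > 0` and `L ≥ 0`) and the abstract mean → pointwise theorem. [folklore] -/
theorem stub_meanToPointwiseTools :
    (∀ (w : ℝ → ℝ) (L C β : ℝ), 0 < L → ContinuousOn w (Set.Ici 0) →
      (∀ s t : ℝ, 0 ≤ s → 0 ≤ t → |w t - w s| ≤ L * |t - s|) →
      (∀ s t : ℝ, 0 ≤ s → s ≤ t → β * (t - s) - C ≤ ∫ τ in s..t, w τ) →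
      ∀ t : ℝ, 0 ≤ t → β - Real.sqrt (2 * C * L) ≤ w t) ∧
    (∀ (w : ℝ → ℝ) (L C β : ℝ), 0 ≤ L → ContinuousOn w (Set.Ici 0) →
      (∀ s t : ℝ, 0 ≤ s → 0 ≤ t → |w t - w s| ≤ L * |t - s|) →
      (∀ s t : ℝ, 0 ≤ s → s ≤ t → β * (t - s) - C ≤ ∫ τ in s..t, w τ) →
      ∀ t : ℝ, 0 ≤ t → β - Real.sqrt (2 * C * L) ≤ w t) ∧
    (∀ {X : Type*} [MeasurableSpace X] (φ : ℝ → X → X) (μ : Measure X) [IsProbabilityMeasure μ]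
      (W : X → ℝ) (β C L : ℝ),
      (∀ t : ℝ, 0 ≤ t → Measurable (φ t)) → (∀ x, φ 0 x = x) →
      (∀ s t : ℝ, 0 ≤ s → 0 ≤ t → ∀ x, φ (s + t) x = φ s (φ t x)) →
      (∀ t : ℝ, 0 ≤ t → μ.map (φ t) = μ) →
      Measurable W → (∃ B : ℝ, ∀ x, |W x| ≤ B) →
      (∀ x, ContinuousOn (fun t => W (φ t x)) (Set.Ici 0)) →
      ∫ x, W x ∂μ = β →
      (∀ᵐ x ∂μ, ∀ t : ℝ, 0 ≤ t → ∫ τ in (0 : ℝ)..t, W (φ τ x) ≤ β * t + C) →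
      0 ≤ L →
      (∀ᵐ x ∂μ, ∀ s t : ℝ, 0 ≤ s → 0 ≤ t → |W (φ t x) - W (φ s x)| ≤ L * |t - s|) →
      ∀ᵐ x ∂μ, ∀ t : ℝ, 0 ≤ t → β - Real.sqrt (2 * C * L) ≤ W (φ t x)) :=
  ⟨fun _ _ _ _ hL hcont hlip hdef => floor_of_boundedDeficit hL hcont hlip hdef,
    fun _ _ _ _ hL hcont hlip hdef => floor_of_boundedDeficit_of_nonneg hL hcont hlip hdef,
    fun φ μ _ W _ _ _ hmeas h0 hsemi hinv hWm hWb hWc hmean hexcess hL hlip =>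
      ae_floor_of_boundedExcess φ μ W hmeas h0 hsemi hinv hWm hWb hWc hmean hexcess hL hlip⟩

end Summit.AnomalousDissipation.AnomalousDissipation.Theorems.UniformGalerkinTrap.Mane

end
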